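import Summits.RiemannHypothesis.RiemannHypothesis.Theorems.LiDirichletAsymptoticCharWindow
import Summits.RiemannHypothesis.RiemannHypothesis.Theorems.LiCoefficientsLiWindowTuring
import Summits.RiemannHypothesis.RiemannHypothesis.Theorems.LiCoefficientsLiFarZeroTail
import Summits.RiemannHypothesis.RiemannHypothesis.Theorems.LiAsymptoticSmoothReplace
import Literature.NumberTheory.LFunctions.DirichletLZeroCountingParityProfile
import Literature.NumberTheory.LFunctions.ZetaZeroCountExplicit
import HarnessLib

/-!
# RiemannHypothesis / LiDirichletAsymptotic — crux K3χ `LiOscillatoryChar`, stub `stub_osc_bmor`: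
# the OSCILLATORY term against the Bennett–Martin–O'Bryant–Rechnitzer remainder (RH-FREE · GRH-FREE)

RH-FREE · GRH-FREE PROOF-OF-DATA (rung L-P(P1⁺χ)) [rh-li-prover].  Route `Theses/LiDirichletAsymptotic.lean`
(cell `pub/rh-li`, round 5 (iii)), item `LiOscillatoryChar` (stmt-RiemannHypothesis-19628, deciding), registered birth
stub `stub_osc_bmor` VERBATIM (`bc/LiOscillatoryChar_birth.lean`): for `χ` primitive mod `q > 1`, `n ≥ 900`, `T' ≥ n²`,
GIVEN the named fact `bmor2021_theorem11` (BMOR 2021 Thm 1.1, a hypothesis — never proved or restated here),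

  `|(charWeightTrace χ n T' − charWeightTrace χ n √n) − (2/π)∫_{√n}^{T'} f_n g_χ|
      ≤ charErrOscB q n + (n²/(2T'²))·bmorRem q T'`.

Proof — the plain stub (`LiDirichletAsymptoticOscPlainChar.lean`) with the remainder `R = N − charCountMainExact`
bounded through BMOR instead of the tree's `argSRem`:
* `|charCountMainExact χ t − ((t/π) log(qt/2πe) − χ(−1)/4)| ≤ 0.03` for `t ≥ 30` (`OscBmor.abs_exact_sub_bmorMain_le`):
  the difference is `(2/π)(θ_a(t) − Stirling_a(t))`, `a = charParity χ`, and the tree's two-sided Stirling bounds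
  (`abs_riemannSiegelTheta_sub_stirling_le`, `DirichletTheta.abs_gammaArgPhase_one_sub_stirling_le`,
  `stirlingVertRate_quarter_lt`) give `≤ (2/π)(1.2/t + 1/(2 sinh πt))`;
* hence, under BMOR (`ℓ = bmorEll q t > 1.567` for `q ≥ 2`, `t ≥ 30`), `|R(t)| ≤ 0.22737 ℓ + 2 log(1+ℓ) − 0.47
  = bmorRem q t − 0.22` (`OscBmor.abs_remainder_le`);
* the remainder integral `∫_a^b |R| |f_n'| ≤ a·(0.22737(ℓ_a + 1) + 2 log(1+ℓ_a) + 2/(1+ℓ_a) − 0.47)` for `a = √n`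
  (`OscBmor.integral_remainder_le`): `ℓ(t) ≤ ℓ_a + log(t/a)`, the tangent `log(1+ℓ(t)) ≤ log(1+ℓ_a) + (ℓ(t) − ℓ_a)/(1+ℓ_a)`,
  and the exact primitive `−n(P + Q(log(t/a) + 1))/t` of `n(P + Q log(t/a))/t²`;
* window identity + `CharCount.abs_finsum_window_sub_integral_le` + sizes of `f_n` as in the plain stub; the constant
  closes because `0.22737(1 − log 2π) + 2/(1+ℓ_a) − 0.47 ≤ 0.13 ≤ 0.42` (the TYPED `charErrOscB`, used verbatim).
Nothing here bears on the truth of RH or GRH; BMOR Thm 1.1 enters only as the hypothesis of the typed conjunct.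
-/

noncomputable section

-- D-0017: `Summit.<S>.<S>.…` is the designed namespace of a single-problem summit.
set_option linter.dupNamespace false

open MeasureTheory intervalIntegral Set Filter
open scoped Topology Real

namespace Summit.RiemannHypothesis.RiemannHypothesis.Theorems.LiTheory

open Literature.NumberTheory.LFunctions Literature.NumberTheory.LFunctions.ExplicitPsiChar
open Literature.NumberTheory.LFunctions.DirichletTheta
open Literature.NumberTheory.LFunctions.DirichletDisc (zeroOrder)

namespace OscBmor

variable {q : ℕ} [NeZero q] {χ : DirichletCharacter ℂ q}

/-! ### The exact main term versus BMOR's main term -/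

omit [NeZero q] in
/-- **`|charCountMainExact χ t − ((t/π) log(qt/(2πe)) − (−1)^{a}/4)| ≤ 0.03`** for `t ≥ 30` (`a = charParity χ`):
the difference is `(2/π)(θ_a(t) − Stirling_a(t))` and the tree's explicit Stirling bounds apply. -/
theorem abs_exact_sub_bmorMain_le (χ : DirichletCharacter ℂ q) (hq : 1 < q) {t : ℝ} (ht : 30 ≤ t) :
    |charCountMainExact χ t -
        (t / Real.pi * Real.log (q * t / (2 * Real.pi * Real.exp 1)) - (-1) ^ charParity χ / 4)| ≤ 0.03 := by
  have hq0 : (0 : ℝ) < q := by exact_mod_cast lt_trans zero_lt_one hq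
  have ht0 : 0 < t := by linarith
  have hπ := Real.pi_gt_d4
  have hK := stirlingVertRate_quarter_lt
  have hlog : Real.log ((q : ℝ) * t / (2 * Real.pi * Real.exp 1)) =
      Real.log q + Real.log (t / (2 * Real.pi)) - 1 := by
    rw [Real.log_div (by positivity) (by positivity), Real.log_mul hq0.ne' ht0.ne',
      Real.log_mul (by positivity) (Real.exp_ne_zero 1), Real.log_exp,
      Real.log_div ht0.ne' (by positivity)]
    ring
  have h2π : 2 / Real.pi ≤ 0.6367 := by
    rw [div_le_iff₀ Real.pi_pos]; nlinarith
  have hKt : 2 * stirlingVertRate (1 / 4) / t ≤ 0.04 := by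
    rw [div_le_iff₀ ht0]; nlinarith
  rcases Nat.le_one_iff_eq_zero_or_eq_one.1 (charParity_le_one χ) with h0 | h1
  · -- even: `θ_0 = θ`, constant `−π/8`, `χ(−1) = 1`
    have hS := abs_riemannSiegelTheta_sub_stirling_le (show (2 : ℝ) ≤ t by linarith)
    have e : charCountMainExact χ t -
        (t / Real.pi * Real.log (q * t / (2 * Real.pi * Real.exp 1)) - (-1) ^ charParity χ / 4) =
        2 / Real.pi * (riemannSiegelTheta t - (t / 2 * Real.log (t / (2 * π)) - t / 2 - π / 8)) := by
      unfold charCountMainExact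
      rw [h0, gammaArgPhase_zero, hlog, pow_zero]
      field_simp
      ring
    rw [e, abs_mul, abs_of_pos (by positivity : (0 : ℝ) < 2 / Real.pi)]
    calc 2 / Real.pi * |riemannSiegelTheta t - (t / 2 * Real.log (t / (2 * π)) - t / 2 - π / 8)|
        ≤ 0.6367 * 0.04 := mul_le_mul h2π (hS.trans hKt) (abs_nonneg _) (by norm_num)
      _ ≤ 0.03 := by norm_num
  · -- odd: `θ_1 = θ + ½ arctan(sinh πt)`, constant `+π/8`, `χ(−1) = −1`
    have hS := abs_gammaArgPhase_one_sub_stirling_le (show (2 : ℝ) ≤ t by linarith)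
    have hsinh : 1 / (2 * Real.sinh (Real.pi * t)) ≤ 0.0054 := by
      have h1 : Real.pi * t ≤ Real.sinh (Real.pi * t) := Real.self_le_sinh_iff.2 (by positivity)
      have h2 : (94 : ℝ) ≤ Real.pi * t := by nlinarith
      rw [div_le_iff₀ (by linarith)]
      nlinarith
    have e : charCountMainExact χ t -
        (t / Real.pi * Real.log (q * t / (2 * Real.pi * Real.exp 1)) - (-1) ^ charParity χ / 4) =
        2 / Real.pi * (gammaArgPhase 1 t - (t / 2 * Real.log (t / (2 * π)) - t / 2 + Real.pi / 8)) := by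
      unfold charCountMainExact
      rw [h1, hlog, pow_one]
      field_simp
      ring
    rw [e, abs_mul, abs_of_pos (by positivity : (0 : ℝ) < 2 / Real.pi)]
    calc 2 / Real.pi * |gammaArgPhase 1 t - (t / 2 * Real.log (t / (2 * π)) - t / 2 + Real.pi / 8)|
        ≤ 0.6367 * (0.04 + 0.0054) :=
          mul_le_mul h2π (hS.trans (add_le_add hKt hsinh)) (abs_nonneg _) (by norm_num)
      _ ≤ 0.03 := by norm_num

omit [NeZero q] in
/-- `bmorEll q t > 1.567` for `q ≥ 2`, `t ≥ 30` (`q(t+2)/2π ≥ 64/2π > e² > e^{1.567}`). -/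
theorem bmorEll_gt (hq : 1 < q) {t : ℝ} (ht : 30 ≤ t) : 1.567 < bmorEll q t := by
  have hq2 : (2 : ℝ) ≤ q := by exact_mod_cast hq
  unfold bmorEll
  rw [Real.lt_log_iff_exp_lt (by positivity)]
  have he := Real.exp_one_lt_d9
  have h2 : Real.exp 2 = Real.exp 1 ^ 2 := by rw [← Real.exp_nat_mul]; norm_num
  have h3 : Real.exp 1.567 < Real.exp 2 := Real.exp_lt_exp.2 (by norm_num)
  have h4 : Real.exp 1.567 < 7.39 := by nlinarith [Real.exp_pos (1 : ℝ)]
  have h5 : Real.exp 1.567 * (2 * Real.pi) < 7.39 * 6.3 :=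
    mul_lt_mul'' h4 (by linarith [Real.pi_lt_d2]) (Real.exp_pos _).le (by positivity)
  have h6 : (2 : ℝ) * 32 ≤ q * (t + 2) := mul_le_mul hq2 (by linarith) (by norm_num) (by linarith)
  rw [lt_div_iff₀ (by positivity)]
  linarith

/-- **The counting remainder under BMOR**: for `χ` primitive mod `q > 1`, `t ≥ 30`, given `bmor2021_theorem11`,
`|N(t, χ) − charCountMainExact χ t| ≤ bmorRem q t − 0.22` (`= 0.22737 ℓ + 2 log(1+ℓ) − 0.5 + 0.03`). -/
theorem abs_remainder_le (hB : bmor2021_theorem11) (hχ : χ.IsPrimitive) (hq : 1 < q) {t : ℝ} (ht : 30 ≤ t) :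
    |(lfunctionZeroCount χ t : ℝ) - charCountMainExact χ t| ≤ bmorRem q t - 0.22 := by
  have h1 := ((hB q hq χ hχ t (by linarith)).2 (bmorEll_gt hq ht))
  have h2 := abs_exact_sub_bmorMain_le χ hq ht
  unfold bmorRem
  have e : (lfunctionZeroCount χ t : ℝ) - charCountMainExact χ t =
      ((lfunctionZeroCount χ t : ℝ) -
          (t / π * Real.log (q * t / (2 * π * Real.exp 1)) - (-1) ^ charParity χ / 4)) -
        (charCountMainExact χ t -
          (t / Real.pi * Real.log (q * t / (2 * Real.pi * Real.exp 1)) - (-1) ^ charParity χ / 4)) := by ring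
  rw [e]
  refine (abs_sub _ _).trans ?_
  linarith

/-! ### The remainder integral -/

omit [NeZero q] in
/-- `ℓ(t) − ℓ(a) ≤ log(t/a)` for `0 < a ≤ t` (`(t+2)/(a+2) ≤ t/a`). -/
theorem bmorEll_sub_le (hq : 1 < q) {a t : ℝ} (ha : 0 < a) (hat : a ≤ t) :
    bmorEll q t - bmorEll q a ≤ Real.log t - Real.log a := by
  have hq0 : (0 : ℝ) < q := by exact_mod_cast lt_trans zero_lt_one hq
  have ht : 0 < t := lt_of_lt_of_le ha hat
  unfold bmorEll
  rw [Real.log_div (by positivity) (by positivity), Real.log_div (by positivity) (by positivity),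
    Real.log_mul hq0.ne' (by linarith), Real.log_mul hq0.ne' (by linarith)]
  have h : Real.log (a * (t + 2)) ≤ Real.log (t * (a + 2)) :=
    Real.log_le_log (by positivity) (by nlinarith)
  rw [Real.log_mul ha.ne' (by linarith), Real.log_mul ht.ne' (by linarith)] at h
  linarith

/-- **The remainder integral under BMOR**: for `χ` primitive mod `q > 1`, `30 ≤ a ≤ b`, with `ℓ_a = bmorEll q a`,
`∫_a^b |N − M_exact|·|f_n'| ≤ n (0.22737 (ℓ_a + 1) + 2 log(1 + ℓ_a) + 2/(1 + ℓ_a) − 0.47)/a`. -/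
theorem integral_remainder_le (hB : bmor2021_theorem11) (hχ : χ.IsPrimitive) (hq : 1 < q) (n : ℕ) {a b : ℝ}
    (ha : 30 ≤ a) (hab : a ≤ b) :
    ∫ t in a..b, |(lfunctionZeroCount χ t : ℝ) - charCountMainExact χ t| * |liWindowWeightDeriv n t| ≤
      n * (0.22737 * (bmorEll q a + 1) + 2 * Real.log (1 + bmorEll q a) + 2 / (1 + bmorEll q a) - 0.47) / a := by
  have hχ1 : χ ≠ 1 := ne_one_of_isPrimitive hχ hq
  have ha0 : 0 < a := by linarith
  have hn : (0 : ℝ) ≤ n := n.cast_nonneg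
  set ℓa : ℝ := bmorEll q a with hℓa
  have hℓa1 : 1.567 < ℓa := bmorEll_gt hq ha
  have h1ℓ : 0 < 1 + ℓa := by linarith
  set P : ℝ := 0.22737 * ℓa + 2 * Real.log (1 + ℓa) - 0.47 with hP
  set Q : ℝ := 0.22737 + 2 / (1 + ℓa) with hQ
  have hQ0 : 0 < Q := by rw [hQ]; positivity
  have hc0 : 0.6931 ≤ Real.log (1 + ℓa) :=
    le_trans (by linarith [Real.log_two_gt_d9]) (Real.log_le_log two_pos (by linarith))
  have hP0 : 0 ≤ P := by rw [hP]; linarith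
  have hIcc : uIcc a b = Icc a b := uIcc_of_le hab
  -- the exact primitive of `n (P + Q log(t/a))/t²`
  set G : ℝ → ℝ := fun t ↦ -((n : ℝ) * (P + Q * (Real.log t - Real.log a + 1)) / t) with hG
  set G' : ℝ → ℝ := fun t ↦ (n : ℝ) * (P + Q * (Real.log t - Real.log a)) / t ^ 2 with hG'
  have hderiv : ∀ t ∈ uIcc a b, HasDerivAt G (G' t) t := by
    intro t ht
    rw [hIcc] at ht
    have ht0 : t ≠ 0 := by linarith [ht.1]
    have h1 : HasDerivAt (fun y : ℝ ↦ (n : ℝ) * (P + Q * (Real.log y - Real.log a + 1)))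
        ((n : ℝ) * (Q * (1 / t))) t := by
      have hl : HasDerivAt (fun y : ℝ ↦ Real.log y - Real.log a + 1) (1 / t) t := by
        have h := ((Real.hasDerivAt_log ht0).sub_const (Real.log a)).add_const 1
        simpa using h
      have h := (hl.const_mul Q).const_add P
      simpa using h.const_mul (n : ℝ)
    have h := (h1.div (hasDerivAt_id t) ht0).neg
    refine h.congr_deriv ?_
    simp only [id, hG']
    field_simp
    ring
  have hG'cont : ContinuousOn G' (uIcc a b) := by
    refine continuousOn_of_forall_continuousAt fun t ht ↦ ?_
    rw [hIcc] at ht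
    have ht0 : t ≠ 0 := by linarith [ht.1]
    have ht2 : t ^ 2 ≠ 0 := pow_ne_zero 2 ht0
    simp only [hG']
    fun_prop (disch := assumption)
  have hG'int : IntervalIntegrable G' volume a b := hG'cont.intervalIntegrable
  -- pointwise domination
  have hptw : ∀ t ∈ Icc a b,
      |(lfunctionZeroCount χ t : ℝ) - charCountMainExact χ t| * |liWindowWeightDeriv n t| ≤ G' t := by
    intro t ht
    have ht30 : 30 ≤ t := le_trans ha ht.1
    have ht0 : 0 < t := by linarith
    have hR := abs_remainder_le hB hχ hq ht30
    have hF := Window.abs_liWindowWeightDeriv_le n ht0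
    -- `ℓ(t) ≤ ℓa + log(t/a)` and the tangent bound for `log(1 + ℓ(t))`
    have hℓt := bmorEll_sub_le hq ha0 ht.1
    have hd : 0 ≤ bmorEll q t - ℓa := by
      have hmono : Real.log ((q : ℝ) * (a + 2) / (2 * Real.pi)) ≤ Real.log ((q : ℝ) * (t + 2) / (2 * Real.pi)) := by
        have hq0 : (0 : ℝ) < q := by exact_mod_cast lt_trans zero_lt_one hq
        exact Real.log_le_log (by positivity) (by gcongr; linarith [ht.1])
      rw [hℓa]; unfold bmorEll; linarith
    have htan : Real.log (1 + bmorEll q t) ≤ Real.log (1 + ℓa) + (bmorEll q t - ℓa) / (1 + ℓa) := by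
      have e : 1 + bmorEll q t = (1 + ℓa) * (1 + (bmorEll q t - ℓa) / (1 + ℓa)) := by
        field_simp; ring
      rw [e, Real.log_mul h1ℓ.ne' (by positivity)]
      have := Real.log_le_sub_one_of_pos (show 0 < 1 + (bmorEll q t - ℓa) / (1 + ℓa) by positivity)
      linarith
    have hfrac : (bmorEll q t - ℓa) / (1 + ℓa) ≤ (Real.log t - Real.log a) / (1 + ℓa) :=
      div_le_div_of_nonneg_right hℓt h1ℓ.le
    have hRle : bmorRem q t - 0.22 ≤ P + Q * (Real.log t - Real.log a) := by
      unfold bmorRem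
      rw [hP, hQ]
      have e : (0.22737 + 2 / (1 + ℓa)) * (Real.log t - Real.log a) =
          0.22737 * (Real.log t - Real.log a) + 2 * ((Real.log t - Real.log a) / (1 + ℓa)) := by ring
      rw [e]
      linarith
    have hmaj0 : 0 ≤ P + Q * (Real.log t - Real.log a) := le_trans ((abs_nonneg _).trans hR) hRle
    calc |(lfunctionZeroCount χ t : ℝ) - charCountMainExact χ t| * |liWindowWeightDeriv n t|
        ≤ (P + Q * (Real.log t - Real.log a)) * (n / t ^ 2) :=
          mul_le_mul (hR.trans hRle) hF (abs_nonneg _) hmaj0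
      _ = G' t := by simp only [hG']; ring
  have hF'c : ContinuousOn (liWindowWeightDeriv n) (uIcc a b) := by
    rw [hIcc]; exact continuousOn_liWindowWeightDeriv n ha0
  have hint : IntervalIntegrable
      (fun t ↦ |(lfunctionZeroCount χ t : ℝ) - charCountMainExact χ t| * |liWindowWeightDeriv n t|) volume a b := by
    have h := (CharCount.intervalIntegrable_remainder_mul hχ1 hF'c).abs
    exact h.congr fun t _ ↦ abs_mul _ _
  have hb0 : 0 < b := lt_of_lt_of_le ha0 hab
  have hGb : G b ≤ 0 := by
    simp only [hG]
    have : 0 ≤ Real.log b - Real.log a := by linarith [Real.log_le_log ha0 hab]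
    have : 0 ≤ (n : ℝ) * (P + Q * (Real.log b - Real.log a + 1)) / b := by positivity
    linarith
  calc ∫ t in a..b, |(lfunctionZeroCount χ t : ℝ) - charCountMainExact χ t| * |liWindowWeightDeriv n t|
      ≤ ∫ t in a..b, G' t := intervalIntegral.integral_mono_on hab hint hG'int hptw
    _ = G b - G a := intervalIntegral.integral_eq_sub_of_hasDerivAt hderiv hG'int
    _ ≤ -G a := by linarith
    _ = n * (0.22737 * (bmorEll q a + 1) + 2 * Real.log (1 + bmorEll q a) + 2 / (1 + bmorEll q a) - 0.47) / a := by
        simp only [hG, hP, hQ, hℓa, sub_self, zero_add]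
        ring

end OscBmor

open OscBmor

/-- **Stub `stub_osc_bmor` of crux `LiOscillatoryChar`** (route `LiDirichletAsymptotic`, stmt-RiemannHypothesis-19628;
RH-FREE · GRH-FREE; BMOR Thm 1.1 is a HYPOTHESIS): for `χ` primitive mod `q > 1`, `n ≥ 900`, `T' ≥ n²`, given
`bmor2021_theorem11`,
`|(charWeightTrace χ n T' − charWeightTrace χ n √n) − (2/π)∫_{√n}^{T'} f_n g_χ| ≤ charErrOscB q n + (n²/(2T'²)) bmorRem q T'`.
Verbatim the registered signature `Sig.stub_osc_bmor`. -/
theorem liOscillatoryChar_bmor :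
    ∀ (q : ℕ) [NeZero q] (χ : DirichletCharacter ℂ q), χ.IsPrimitive → 1 < q →
      ∀ (n : ℕ) (T' : ℝ), (n : ℝ) ^ 2 ≤ T' → bmor2021_theorem11 → 900 ≤ n →
        |(charWeightTrace χ n T' - charWeightTrace χ n (Real.sqrt n))
            - 2 / Real.pi * (∫ t in Real.sqrt n..T', liWindowWeight n t * charGammaDensity χ t)| ≤
          charErrOscB q n + (n : ℝ) ^ 2 / (2 * T' ^ 2) * bmorRem q T' := by
  intro q _ χ hχ hq n T' hT' hB hn
  have hχ1 : χ ≠ 1 := ne_one_of_isPrimitive hχ hq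
  have hq0 : (0 : ℝ) < q := by exact_mod_cast lt_trans zero_lt_one hq
  have hnR : (900 : ℝ) ≤ n := by exact_mod_cast hn
  have hn0 : (0 : ℝ) ≤ n := by positivity
  -- sizes
  set a := Real.sqrt n with ha_def
  have ha2 : a ^ 2 = n := Real.sq_sqrt hn0
  have ha30 : 30 ≤ a := by
    rw [ha_def, show (30 : ℝ) = Real.sqrt (30 ^ 2) by rw [Real.sqrt_sq (by norm_num)]]
    exact Real.sqrt_le_sqrt (by linarith)
  have ha0 : 0 < a := by linarith
  have hab : a ≤ T' := by nlinarith
  have hT'30 : 30 ≤ T' := le_trans ha30 hab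
  have hT'0 : 0 < T' := by linarith
  -- the window sum is `∑ m f_n(|γ|)`
  have hW : charWeightTrace χ n T' - charWeightTrace χ n a =
      ∑ᶠ ρ ∈ lfunctionZeroBox χ T' \ lfunctionZeroBox χ a, (zeroOrder χ ρ : ℝ) * liWindowWeight n |ρ.im| := by
    rw [CharCount.charWeightTrace_sub hχ1 n hab]
    refine finsum_mem_congr rfl fun ρ hρ ↦ ?_
    have hρa : a < |ρ.im| := (CharCount.mem_window.1 hρ).2
    have hne : |ρ.im| ≠ 0 := by linarith
    simp only [liWindowWeight₀, hne, if_false]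
  have hI : 2 / Real.pi * (∫ t in a..T', liWindowWeight n t * charGammaDensity χ t) =
      ∫ t in a..T', liWindowWeight n t * (2 / Real.pi * charGammaDensity χ t) := by
    rw [← intervalIntegral.integral_const_mul]
    exact intervalIntegral.integral_congr fun t _ ↦ by ring
  have hmain := CharCount.abs_finsum_window_sub_integral_le hχ1 hab (F := liWindowWeight n)
    (F' := liWindowWeightDeriv n) (fun t ht ↦ hasDerivAt_liWindowWeight n (by linarith [ht.1] : t ≠ 0))
    (continuousOn_liWindowWeightDeriv n ha0)
  rw [hW, hI]
  refine hmain.trans ?_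
  -- the three pieces
  have hRT := abs_remainder_le hB hχ hq hT'30
  have hRa := abs_remainder_le hB hχ hq ha30
  obtain ⟨hfT0, -⟩ := SmoothReplace.liWindowWeight_mem n T'
  obtain ⟨hfa0, hfa2⟩ := SmoothReplace.liWindowWeight_mem n a
  have hfT := SmoothReplace.liWindowWeight_le_sq n hT'0
  have hbT : 0 ≤ bmorRem q T' - 0.22 := (abs_nonneg _).trans hRT
  have hba : 0 ≤ bmorRem q a - 0.22 := (abs_nonneg _).trans hRa
  have htop : |(lfunctionZeroCount χ T' : ℝ) - charCountMainExact χ T'| * |liWindowWeight n T'| ≤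
      (bmorRem q T' - 0.22) * ((n : ℝ) ^ 2 / (2 * T' ^ 2)) := by
    rw [abs_of_nonneg hfT0]
    exact mul_le_mul hRT hfT hfT0 hbT
  have hbot : |(lfunctionZeroCount χ a : ℝ) - charCountMainExact χ a| * |liWindowWeight n a| ≤
      (bmorRem q a - 0.22) * 2 := by
    rw [abs_of_nonneg hfa0]
    exact mul_le_mul hRa hfa2 hfa0 hba
  have hint := integral_remainder_le hB hχ hq n ha30 hab
  -- numerics
  have hX0 : 0 ≤ (n : ℝ) ^ 2 / (2 * T' ^ 2) := by positivity
  have hℓ : bmorEll q a = Real.log q + Real.log (a + 2) - Real.log (2 * Real.pi) := by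
    unfold bmorEll
    rw [Real.log_div (by positivity) (by positivity), Real.log_mul hq0.ne' (by linarith)]
  have hℓ1 : 1.567 < bmorEll q a := bmorEll_gt hq ha30
  have h2ℓ : 2 / (1 + bmorEll q a) ≤ 0.78 := by
    rw [div_le_iff₀ (by linarith)]; linarith
  have h2π := FarZeroTail.log_two_pi_ge
  have hint' : (n : ℝ) * (0.22737 * (bmorEll q a + 1) + 2 * Real.log (1 + bmorEll q a)
        + 2 / (1 + bmorEll q a) - 0.47) / a =
      a * (0.22737 * (bmorEll q a + 1) + 2 * Real.log (1 + bmorEll q a) + 2 / (1 + bmorEll q a) - 0.47) := by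
    rw [← ha2]; field_simp
  rw [hint'] at hint
  have hkey : a * (0.22737 * (bmorEll q a + 1) + 2 * Real.log (1 + bmorEll q a)
        + 2 / (1 + bmorEll q a) - 0.47) ≤
      a * (0.22737 * (Real.log q + Real.log (a + 2)) + 2 * Real.log (1 + bmorEll q a) + 0.42) - 0.29 * a := by
    rw [hℓ] at h2ℓ ⊢
    nlinarith [mul_le_mul_of_nonneg_left h2ℓ ha0.le, mul_le_mul_of_nonneg_left h2π ha0.le]
  unfold charErrOscB
  rw [← ha_def]
  nlinarith [mul_nonneg hbT hX0]

end Summit.RiemannHypothesis.RiemannHypothesis.Theorems.LiTheory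

end
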